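import Summits.PneNP.PneNP.Theses.ConvexRankGates
import Summits.PneNP.PneNP.Theorems.CliqueExtLowerBound.Negative.LoadBearing
import Literature.Computability.Complexity.ExtMonotoneCircuits
import Literature.Computability.Complexity.ExtMonotoneGRankSupport
import Literature.Computability.Complexity.MonotoneSwitching
import Literature.Computability.Complexity.CliqueTestGraphs

/-!
# Line `width-threshold-certificate-sparsity` — skeleton for the crux `ConvexRankGates.CliqueExtLowerBound`
(crux item stmt-PneNP-10682, rank 5 of route PneNP/ConvexRankGates; planner crux-plan seat, round 1)

THE LINE (Jukna's two-sided criterion in EVENT currency, wide gates by effective simplicity).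
Fix `δ₀ = 1/4`, `k(m) = ⌈m^{1/4}⌉₊`, and the referee pair
POSITIVES `posFam m` = bare `k`-cliques (`posGraphs`), NEGATIVES `negFam m` = complements of the
`t(m)`-edge graphs, `t = #E(K_m) / ⌊m^{1/8}⌋₊` (missing-edge density `γ ≈ m^{-1/8} ≫ 4 ln m / k`, so a
negative is `k`-clique-free with overwhelming probability; log-free on purpose).
Run the CNF/DNF approximation of Jukna 2012 §9.3–9.4 (tree: `MonotoneSwitching.lean`, Lemma 9.15 and
Theorem 9.17 are PROVED there for `{∧₂,∨₂,0,1}`) along a `B_{m^c}`-circuit with CONSTANT localities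
`r, s = O(c)` and charge every approximation error not to global exact correcting families but to two
ERROR EVENTS, one inside `posFam`, one inside `negFam`, of relative mass `ε(m,c) = 1/(8 m^{c+1})` per gate
and per side (`Sandwichable`, §2). The engine (`stub_engine`, generic, provable now) turns per-gate
sandwichability into "the output pair cannot tell the referee families apart", and the referee lemma
(`stub_referee`: most negatives are clique-free, most positives miss any `s` fixed edges) finishes.
What a gate must supply is therefore ONE statement per gate CLASS, with the children restricted to
what the induction actually feeds it — `(r-1)`-DNFs on the positive side, `(s-1)`-CNFs on the negative
side:

* WIDTH THRESHOLD (the card's first lever, worst case, provable now): a PERM_d gate has minterms of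
  length `≤ log₂ d!` (a minimal generating set is a strict subgroup chain in `Sym d`), a GRANK_d gate of
  length `≤ θ ≤ d` (tree `IsGRankGate.eq_true_iff_exists_support`), so such a gate applied to
  `(r-1)`-DNF children is an `L`-DNF OVER THE EDGES, `L ≤ (r-1) log₂ d!`; one monotone switching costs
  `L^s` exact `s`-clauses of negative mass `γ^s` each — free as long as `d ≤ T(m) = ⌊m^{1/16}⌋₊ = k^{1/4}`
  (`stub_narrowAlgebraic`). For CONV gates WIDTH ≠ ARITY (triage r1-1/r1-2: a width-1 CONV gate is an
  unbounded fan-in threshold), so the CONV class gets no syntactic threshold; few-CONSTRAINT CONV gates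
  are free by Jukna's real-gate criterion (Thm 9.21), recorded in the line card, not needed here.
* INLINE EXPANSION (worst case, provable now): a gate whose function has a `{∧₂,∨₂,0,1}`-circuit of
  size `≤ m^a` over its children is sandwichable — run Theorem 9.17's two cases through that circuit
  with the children's pairs as leaves (`stub_inline`; the budget is `m^a (r-1)^s γ^s + m^a (s-1)^r
  (k/m)^{v(r)}`, `v(r)` = least number of vertices spanned by `r` edges).
* THE RESIDUE (the card's "certificate sparsity / effective minterm width", made TWO-SIDED): every wide
  gate of `B_{m^c}` is, on the referee push-forwards, REPLACEABLE by a gate of polynomial monotone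
  complexity — it accepts positives (through DNF children) only where the replacement does and the
  replacement accepts negatives (through CNF children) only where the gate does, up to mass `ε`
  (`Replaceable`, §2; `stub_convReplaceable` for CONV incl. `∧₂, ∨₂`; `stub_algebraicReplaceable` for
  PERM/GRANK above the threshold). One-sided versions are FALSE and are not filed (line card §Disproof:
  `PM^d ∨ x_e` needs exponentially many rejection certificates yet is replaceable by `x_e`;
  `THR_{C(k,2)}` accepts every bare clique only through a `C(k,2)`-edge witness yet is replaceable by `1`).

`CliqueExtLowerBound_of` composes the six stubs into the crux BY NAME with a real proof: choose
`r, s` as maxima of the stub thresholds, intersect the eventualities, feed every gate class into the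
engine (`mem_extGate_iff`; `∧₂, ∨₂ ∈ CONV₁`), kill both exits of the engine with the referee lemma, and
cross the bridge `Negative.cliqueExtLowerBound_iff` (landed, LoadBearing.lean) at `δ = 1/4`.

Disproof.lean / Negative lemmas honoured (imported `LoadBearing`): the size bound is used by the
engine (`M.size * ε`), the width bound `≤ m^c` by the two Replaceable stubs (they quantify over
`IsConvGate (m^c)`, `IsPermGate (m^c)`, `IsGRankGate (m^c)` — the one-gate kills of
`not_lowerBoundAt_of_choose_le`, `exists_onePermGate_computes`, `grank_sees_every_clique` all have width
`≥ C(m,k) ≫ m^c`), the order `∀ c, ∀ᶠ m` is literally the order of every stub, `k → ∞` and `m - k → ∞`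
enter through `stub_referee` (clique-freeness of the negatives needs `γ·C(k,2) ≫ k ln m`; edge-avoidance
of the positives needs `k ≪ m`), and no stub is an instance of a landed Negative lemma (none asserts a
lower bound for a single wide gate at width `≥ C(m,k)`).
-/

set_option linter.dupNamespace false
set_option linter.unusedSectionVars false

open Literature.Computability.Complexity Filter Finset
open Summit.PneNP.PneNP.Theorems.CliqueExtLowerBound.Negative (LowerBoundAt cliqueExtLowerBound_iff
  ceil_rpow_le)

noncomputable section

namespace Summit.PneNP.PneNP.Cruxes.CliqueExtLowerBound.WidthThresholdCertificateSparsity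

/-! ## §1 Parameters and the referee pair (`δ₀ = 1/4`) -/

/-- The edge slots of `K_m` (the input variables of the crux). -/
abbrev EV (m : ℕ) : Type := (⊤ : SimpleGraph (Fin m)).edgeSet

/-- Clique size `k(m) = ⌈m^{1/4}⌉₊` (the crux's `⌈m^δ⌉₊` at `δ = 1/4`). -/
def kk (m : ℕ) : ℕ := ⌈(m : ℝ) ^ (1 / 4 : ℝ)⌉₊

/-- Number of edge slots `#E(K_m)`. -/
def nN (m : ℕ) : ℕ := Fintype.card (EV m)

/-- Density denominator `D(m) = ⌊m^{1/8}⌋₊`: a negative misses `#E / D` edges (`γ ≈ m^{-1/8}`). -/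
def dD (m : ℕ) : ℕ := ⌊(m : ℝ) ^ (1 / 8 : ℝ)⌋₊

/-- Number of missing edges of a negative, `t(m) = #E(K_m) / ⌊m^{1/8}⌋₊`. -/
def tt (m : ℕ) : ℕ := nN m / dD m

/-- The width threshold `T(m) = ⌊m^{1/16}⌋₊ = k^{1/4}` below which PERM/GRANK gates are free. -/
def TT (m : ℕ) : ℕ := ⌊(m : ℝ) ^ (1 / 16 : ℝ)⌋₊

/-- Per-gate, per-side error budget `ε(m,c) = 1 / (8 m^{c+1})` (a circuit has `≤ m^c` gates). -/
def eps (m c : ℕ) : ℝ := 1 / (8 * (m : ℝ) ^ (c + 1))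

/-- POSITIVES: the bare `k`-cliques (clique vectors of the `k`-subsets). -/
def posFam (m : ℕ) : Finset (EV m → Bool) := posGraphs m (kk m)

/-- NEGATIVES: complements of the `t(m)`-edge graphs (uniform Erdős–Rényi model `G(m, #E - t)`). -/
def negFam (m : ℕ) : Finset (EV m → Bool) :=
  (powersetCard (tt m) (univ : Finset (EV m))).image fun M => fun e => decide (e ∉ M)

/-! ## §2 The event currency: local pairs, sandwichable and replaceable gates -/

section Currency

variable {ι : Type} [DecidableEq ι]

/-- A monotone DNF/CNF family (set of monomials / clauses) is `w`-local if every member has fewer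
than `w` variables (the tree's `(w-1)`-DNF / `(w-1)`-CNF convention of `MonotoneSwitching`). -/
def IsLocal (w : ℕ) (F : Finset (Finset ι)) : Prop := ∀ R ∈ F, #R ≤ w - 1

open Classical in
/-- Values of a tuple of DNFs at the input `x` (what a gate sees on the POSITIVE side). -/
def dval {n : ℕ} (d : Fin n → Finset (Finset ι)) (x : ι → Bool) : Fin n → Bool :=
  fun j => decide (EvalDNF (d j) x)

open Classical in
/-- Values of a tuple of CNFs at the input `x` (what a gate sees on the NEGATIVE side). -/
def cval {n : ℕ} (c : Fin n → Finset (Finset ι)) (x : ι → Bool) : Fin n → Bool :=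
  fun j => decide (EvalCNF (c j) x)

open Classical in
/-- `φ` is `(r,s)`-SANDWICHABLE on the referee pair `(P, N)` with error `ε`, for children drawn from at
most `A` distinct local pairs: for all tuples of `r`-local DNFs `d ≤` `s`-local CNFs `c` (one pair per
input position) there is an `r`-local DNF `dnf ≤` an `s`-local CNF `cnf` such that
`φ(d(x)) ≤ dnf(x)` for all but `ε·#P` positives `x ∈ P` and `cnf(x) ≤ φ(c(x))` for all but `ε·#N`
negatives `x ∈ N`. This is exactly what one induction step of the two-sided approximation needs
(Jukna 2012, proof of Thm 9.17, with errors charged to events instead of correcting families). -/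
def Sandwichable (r s A : ℕ) (P N : Finset (ι → Bool)) (ε : ℝ) (φ : GateFn) : Prop :=
  ∀ (d c : Fin φ.1 → Finset (Finset ι)),
    #(univ.image fun j => (d j, c j)) ≤ A →
    (∀ j, IsLocal r (d j)) → (∀ j, IsLocal s (c j)) →
    (∀ j x, EvalDNF (d j) x → EvalCNF (c j) x) →
    ∃ dnf cnf : Finset (Finset ι), IsLocal r dnf ∧ IsLocal s cnf ∧
      (∀ x, EvalDNF dnf x → EvalCNF cnf x) ∧
      (#(P.filter fun x => φ.2 (dval d x) = true ∧ ¬ EvalDNF dnf x) : ℝ) ≤ ε * #P ∧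
      (#(N.filter fun x => EvalCNF cnf x ∧ φ.2 (cval c x) = false) : ℝ) ≤ ε * #N

open Classical in
/-- `φ` is REPLACEABLE by monotone complexity `a` on the referee pair (the line's residue notion): for
all tuples of local children as above there is a circuit `Ψ` over `{∧₂, ∨₂, 0, 1}` with `≤ a` gates on the
input positions of `φ` such that `φ(d(x)) ≤ Ψ(d(x))` for all but `ε·#P` positives and
`Ψ(c(x)) ≤ φ(c(x))` for all but `ε·#N` negatives. One-sided special cases: `Ψ ≥ φ` an AND of few sound
rejection certificates ("certificate sparsity"), `Ψ ≤ φ` an OR of few short minterms ("effective minterm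
width"), `Ψ ∈ {0, 1}` for gates blind on one family. -/
def Replaceable (r s A a : ℕ) (P N : Finset (ι → Bool)) (ε : ℝ) (φ : GateFn) : Prop :=
  ∀ (d c : Fin φ.1 → Finset (Finset ι)),
    #(univ.image fun j => (d j, c j)) ≤ A →
    (∀ j, IsLocal r (d j)) → (∀ j, IsLocal s (c j)) →
    (∀ j x, EvalDNF (d j) x → EvalCNF (c j) x) →
    ∃ Ψ : Circuit (Fin φ.1), Ψ.IsOver monotoneBasis01 ∧ Ψ.size ≤ a ∧
      (#(P.filter fun x => φ.2 (dval d x) = true ∧ Ψ.eval (dval d x) = false) : ℝ) ≤ ε * #P ∧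
      (#(N.filter fun x => Ψ.eval (cval c x) = true ∧ φ.2 (cval c x) = false) : ℝ) ≤ ε * #N

open Classical in
/-- INLINE FREENESS at monotone complexity `a`: every `{∧₂,∨₂,0,1}`-circuit with `≤ a` gates, fed with
local pairs `d ≤ c`, has an output pair `dnf ≤ cnf` with `Ψ(d(x)) ≤ dnf(x)` off `ε·#P` positives and
`cnf(x) ≤ Ψ(c(x))` off `ε·#N` negatives (Jukna's Theorem 9.17 run through `Ψ` with the children's pairs
as leaves; worst case, no distributional input beyond the two mass computations). -/
def InlineFree (r s a : ℕ) (P N : Finset (ι → Bool)) (ε : ℝ) : Prop :=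
  ∀ (n : ℕ) (Ψ : Circuit (Fin n)), Ψ.IsOver monotoneBasis01 → Ψ.size ≤ a →
    ∀ (d c : Fin n → Finset (Finset ι)),
      (∀ j, IsLocal r (d j)) → (∀ j, IsLocal s (c j)) →
      (∀ j x, EvalDNF (d j) x → EvalCNF (c j) x) →
      ∃ dnf cnf : Finset (Finset ι), IsLocal r dnf ∧ IsLocal s cnf ∧
        (∀ x, EvalDNF dnf x → EvalCNF cnf x) ∧
        (#(P.filter fun x => Ψ.eval (dval d x) = true ∧ ¬ EvalDNF dnf x) : ℝ) ≤ ε * #P ∧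
        (#(N.filter fun x => EvalCNF cnf x ∧ Ψ.eval (cval c x) = false) : ℝ) ≤ ε * #N

end Currency

/-! ## §3 The six stub statements -/

/-- ENGINE (generic two-sided approximation in event currency; Jukna 2012 Thm 9.17 with pluggable gates).
Along a circuit all of whose gates are monotone and `(r,s)`-sandwichable on `(P,N)` with error `ε`,
every wire gets a local pair; the output pair of a circuit computing `f` then shows: EITHER all but
`size·ε·#N` negatives are accepted by `f` (the final CNF is empty), OR some clause of fewer than `s`
variables is hit by all but `size·ε·#P` of the positives accepted by `f`. -/
def EngineStatement : Prop :=
  ∀ (ι : Type) [Fintype ι] [DecidableEq ι] (r s A : ℕ), 2 ≤ r → 2 ≤ s →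
    ∀ (P N : Finset (ι → Bool)) (ε : ℝ), 0 ≤ ε → ∀ M : Circuit ι,
      Fintype.card ι + M.size + 1 ≤ A → (∀ g ∈ M.gates, Monotone g.op) →
      (∀ g ∈ M.gates, Sandwichable r s A P N ε g.fn) →
      ∀ f : (ι → Bool) → Bool, M.Computes f →
        (#(N.filter fun x => f x = false) : ℝ) ≤ M.size * ε * #N ∨
          ∃ q : Finset ι, #q ≤ s - 1 ∧
            (#(P.filter fun x => f x = true ∧ ∀ i ∈ q, x i = false) : ℝ) ≤ M.size * ε * #P

/-- REFEREE (nondegeneracy of the pair, first-moment estimates): eventually in `m`, at most a quarter of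
the negatives contain a `k`-clique (`E #cliques ≤ C(m,k) (1 - t/#E)^{C(k,2)} ≤ m^k e^{-γ C(k,2)} → 0`
since `γ C(k,2) ≈ m^{3/8}/2 ≫ k ln m`), and for every set `q` of at most `s` edges at most a quarter of
the positives meet `q` (`≤ s · C(m-2,k-2)/C(m,k) ≤ s k²/m² → 0`). -/
def RefereeStatement : Prop :=
  ∀ s : ℕ, ∀ᶠ m : ℕ in atTop,
    4 * #((negFam m).filter fun x => cliqueFn m (kk m) x = true) ≤ #(negFam m) ∧
    ∀ q : Finset (EV m), #q ≤ s →
      4 * #((posFam m).filter fun x => ∃ e ∈ q, x e = true) ≤ #(posFam m)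

/-- INLINE (worst case; Jukna 2012 Lemma 9.15 ×2 per `∧`/`∨` gate of `Ψ`, tree `ApproxInv.and_gate` /
`or_gate` with the invariant split into "lower vs `Ψ ∘ c`, upper vs `Ψ ∘ d`", plus the two mass lemmas:
an exact `s`-clause fails on at most `(t/#E)^s ≤ m^{-s/8}` of `negFam`, an exact `r`-monomial lies inside at
most `(k/m)^{v(r)}` of `posFam`): monotone complexity `m^a` is free once `r ≥ r₀(a,c)`, `s ≥ s₀(a,c)`. -/
def InlineStatement : Prop :=
  ∀ a c : ℕ, ∃ r₀ s₀ : ℕ, 2 ≤ r₀ ∧ 2 ≤ s₀ ∧ ∀ r s : ℕ, r₀ ≤ r → s₀ ≤ s →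
    ∀ᶠ m : ℕ in atTop, InlineFree r s (m ^ a) (posFam m) (negFam m) (eps m c)

/-- NARROW ALGEBRAIC GATES ARE FREE (the width threshold; worst case): a PERM or GRANK gate of width
`≤ T(m) = ⌊m^{1/16}⌋₊`, applied to `r`-local DNF children, is an `L`-DNF over the edges with
`L ≤ (r-1)·log₂(T!)` (PERM: strict subgroup chains in `Sym T`; GRANK: one monomial of a `θ`-minor,
`θ ≤ T`, tree `le_rank_symbolicMatrix_iff`); switch it up and down once (`monotoneSwitching_dnf/_cnf`):
`L^s` exact `s`-clauses of negative mass `≤ (t/#E)^s` each and `(s-1)^r` exact `r`-monomials of positive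
mass `≤ (k/m)^{v(r)}` each, i.e. `(L m^{-1/8})^s + (s-1)^r m^{-3 v(r)/4} ≤ ε(m,c)` eventually. -/
def NarrowAlgebraicStatement : Prop :=
  ∀ c : ℕ, ∃ r₀ s₀ : ℕ, 2 ≤ r₀ ∧ 2 ≤ s₀ ∧ ∀ r s : ℕ, r₀ ≤ r → s₀ ≤ s →
    ∀ᶠ m : ℕ in atTop, ∀ φ : GateFn, (IsPermGate (TT m) φ ∨ IsGRankGate (TT m) φ) →
      Sandwichable r s (m ^ (c + 3)) (posFam m) (negFam m) (eps m c) φ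

/-- WIDE ALGEBRAIC GATES ARE REPLACEABLE (distributional residue, PERM/GRANK of width in
`(T(m), m^c]`): on the referee push-forwards through `≤ m^{c+3}` distinct local child pairs, a
group-membership / generic-rank gate is indistinguishable (positives from above, negatives from below,
up to mass `ε(m,c)`) from a gate of monotone complexity `m^a`, `a = a(c)`. Heuristic witnesses: the OR of
its minterms of length `≤ √k` (short subgroup words / supports of low-degree minor monomials), the AND of
few killing functionals (Disproof §7: PERM ⊇ span programs over every `𝔽_p`), or a constant. -/
def AlgebraicReplaceableStatement : Prop :=
  ∀ c : ℕ, ∃ a : ℕ, ∀ r s : ℕ, 2 ≤ r → 2 ≤ s →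
    ∀ᶠ m : ℕ in atTop, ∀ φ : GateFn, (IsPermGate (m ^ c) φ ∨ IsGRankGate (m ^ c) φ) →
      ¬ (IsPermGate (TT m) φ ∨ IsGRankGate (TT m) φ) →
      Replaceable r s (m ^ (c + 3)) (m ^ a) (posFam m) (negFam m) (eps m c) φ

/-- CONV GATES ARE REPLACEABLE (distributional residue, the hardest stub; includes `∧₂, ∨₂ ∈ CONV₁` and all
thresholds): on the referee push-forwards through `≤ m^{c+3}` distinct local child pairs, an
SDP-feasibility gate of width `≤ m^c` is indistinguishable (as above) from a gate of monotone complexity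
`m^a`. Heuristic witnesses: the AND of polynomially many SOUND rejection certificates `[w·u ≥ β]`, `w ≥ 0`
(Farkas duals for LP data; semantic soundness sidesteps the uncertified rejections of Disproof §8), each a
weighted threshold of the children (monotone complexity poly, Beimel–Weinreb / Jukna Thm 9.21); a constant
for gates blind on one family (theta at every level: Coja-Oghlan 2005, JonesEtAl2022). -/
def ConvReplaceableStatement : Prop :=
  ∀ c : ℕ, ∃ a : ℕ, ∀ r s : ℕ, 2 ≤ r → 2 ≤ s →
    ∀ᶠ m : ℕ in atTop, ∀ φ : GateFn, IsConvGate (m ^ c) φ →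
      Replaceable r s (m ^ (c + 3)) (m ^ a) (posFam m) (negFam m) (eps m c) φ

/-! ## §4 Registered stubs (lead reshape, 2026-08-16)

The `stub_*` theorems are the registered obligations (sorried). Their signatures are the statements
`EngineStatement`, …, `ConvReplaceableStatement` of §3 UNFOLDED down to Literature + Mathlib vocabulary
(`posFam`, `negFam`, `eps`, `kk`, `TT`, `Sandwichable`, `Replaceable`, `InlineFree`, `dval`, `cval`,
`IsLocal` substituted by their bodies — no `let`s, the stub registry reads signatures textually), so that every stub can be
proved and LANDED in its own `Theorems/` file importing only the tree — no dependence on a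
definitions file of this line. Each `stub_X` is definitionally equal to `XStatement` (δ/ζ-reduction),
which is how `CliqueExtLowerBound_of` consumes them. Workers: copy the signature VERBATIM, including the
`open Classical in` prefix (it fixes the `Decidable` instances inside the `filter`s). -/

open Classical in
/-- STUB `stub_engine` (M; provable now from `MonotoneSwitching.lean`): the event-currency engine —
Jukna 2012 Thm 9.17 along a circuit of arbitrary monotone gates, each gate passed by its
sandwichability hypothesis, errors collected in two global bad sets. (= `EngineStatement`.) -/
theorem stub_engine :
    ∀ (ι : Type) [Fintype ι] [DecidableEq ι] (r s A : ℕ), 2 ≤ r → 2 ≤ s →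
    ∀ (P N : Finset (ι → Bool)) (ε : ℝ), 0 ≤ ε → ∀ M : Circuit ι,
      Fintype.card ι + M.size + 1 ≤ A → (∀ g ∈ M.gates, Monotone g.op) →
      (∀ g ∈ M.gates, ∀ (D C : Fin g.arity → Finset (Finset ι)),
        #(univ.image fun j => (D j, C j)) ≤ A →
        (∀ j, ∀ R ∈ D j, #R ≤ r - 1) → (∀ j, ∀ S ∈ C j, #S ≤ s - 1) →
        (∀ j x, EvalDNF (D j) x → EvalCNF (C j) x) →
        ∃ dnf cnf : Finset (Finset ι), (∀ R ∈ dnf, #R ≤ r - 1) ∧ (∀ S ∈ cnf, #S ≤ s - 1) ∧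
          (∀ x, EvalDNF dnf x → EvalCNF cnf x) ∧
          (#(P.filter fun x => g.op (fun j => decide (EvalDNF (D j) x)) = true ∧ ¬ EvalDNF dnf x) : ℝ)
              ≤ ε * #P ∧
          (#(N.filter fun x => EvalCNF cnf x ∧ g.op (fun j => decide (EvalCNF (C j) x)) = false) : ℝ)
              ≤ ε * #N) →
      ∀ f : (ι → Bool) → Bool, M.Computes f →
        (#(N.filter fun x => f x = false) : ℝ) ≤ M.size * ε * #N ∨
          ∃ q : Finset ι, #q ≤ s - 1 ∧
            (#(P.filter fun x => f x = true ∧ ∀ i ∈ q, x i = false) : ℝ) ≤ M.size * ε * #P := by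
  sorry

open Classical in
/-- STUB `stub_referee` (M; provable now, first-moment counting): the referee pair is nondegenerate —
eventually in `m`, at most a quarter of the negatives (complements of the `t`-edge graphs,
`t = #E/⌊m^{1/8}⌋₊`) contain a `⌈m^{1/4}⌉₊`-clique, and for every set `q` of at most `s` edges at
most a quarter of the positives (bare `⌈m^{1/4}⌉₊`-cliques) meet `q`. (= `RefereeStatement`.) -/
theorem stub_referee : ∀ s : ℕ, ∀ᶠ m : ℕ in atTop,
    4 * #((((powersetCard (Fintype.card ((⊤ : SimpleGraph (Fin m)).edgeSet) / ⌊(m : ℝ) ^ (1 / 8 : ℝ)⌋₊)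
          (univ : Finset ((⊤ : SimpleGraph (Fin m)).edgeSet))).image (fun M => fun e => decide (e ∉ M)))).filter
          (fun x => cliqueFn m ⌈(m : ℝ) ^ (1 / 4 : ℝ)⌉₊ x = true)) ≤
      #(((powersetCard (Fintype.card ((⊤ : SimpleGraph (Fin m)).edgeSet) / ⌊(m : ℝ) ^ (1 / 8 : ℝ)⌋₊)
          (univ : Finset ((⊤ : SimpleGraph (Fin m)).edgeSet))).image (fun M => fun e => decide (e ∉ M)))) ∧
    ∀ q : Finset ((⊤ : SimpleGraph (Fin m)).edgeSet), #q ≤ s →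
      4 * #((posGraphs m ⌈(m : ℝ) ^ (1 / 4 : ℝ)⌉₊).filter (fun x => ∃ e ∈ q, x e = true)) ≤
        #(posGraphs m ⌈(m : ℝ) ^ (1 / 4 : ℝ)⌉₊) := by
  sorry

open Classical in
/-- STUB `stub_inline` (M/L; provable now): inline expansion — a `{∧₂,∨₂,0,1}`-circuit with `≤ m^a`
gates fed with local pairs `D ≤ C` has an output pair, errors charged to the two referee families
(Jukna 2012 Thm 9.17 with pairs as leaves + two mass lemmas). (= `InlineStatement`.) -/
theorem stub_inline : ∀ a c : ℕ, ∃ r₀ s₀ : ℕ, 2 ≤ r₀ ∧ 2 ≤ s₀ ∧ ∀ r s : ℕ, r₀ ≤ r → s₀ ≤ s →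
    ∀ᶠ m : ℕ in atTop,
      ∀ (n : ℕ) (Ψ : Circuit (Fin n)), Ψ.IsOver monotoneBasis01 → Ψ.size ≤ m ^ a →
      ∀ (D C : Fin n → Finset (Finset ((⊤ : SimpleGraph (Fin m)).edgeSet))),
        (∀ j, ∀ R ∈ D j, #R ≤ r - 1) → (∀ j, ∀ S ∈ C j, #S ≤ s - 1) →
        (∀ j x, EvalDNF (D j) x → EvalCNF (C j) x) →
        ∃ dnf cnf : Finset (Finset ((⊤ : SimpleGraph (Fin m)).edgeSet)),
          (∀ R ∈ dnf, #R ≤ r - 1) ∧ (∀ S ∈ cnf, #S ≤ s - 1) ∧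
          (∀ x, EvalDNF dnf x → EvalCNF cnf x) ∧
          (#((posGraphs m ⌈(m : ℝ) ^ (1 / 4 : ℝ)⌉₊).filter
              (fun x => Ψ.eval (fun j => decide (EvalDNF (D j) x)) = true ∧ ¬ EvalDNF dnf x)) : ℝ)
            ≤ (1 / (8 * (m : ℝ) ^ (c + 1))) * #(posGraphs m ⌈(m : ℝ) ^ (1 / 4 : ℝ)⌉₊) ∧
          (#((((powersetCard (Fintype.card ((⊤ : SimpleGraph (Fin m)).edgeSet) / ⌊(m : ℝ) ^ (1 / 8 : ℝ)⌋₊)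
          (univ : Finset ((⊤ : SimpleGraph (Fin m)).edgeSet))).image (fun M => fun e => decide (e ∉ M)))).filter
              (fun x => EvalCNF cnf x ∧ Ψ.eval (fun j => decide (EvalCNF (C j) x)) = false)) : ℝ)
            ≤ (1 / (8 * (m : ℝ) ^ (c + 1))) *
              #(((powersetCard (Fintype.card ((⊤ : SimpleGraph (Fin m)).edgeSet) / ⌊(m : ℝ) ^ (1 / 8 : ℝ)⌋₊)
          (univ : Finset ((⊤ : SimpleGraph (Fin m)).edgeSet))).image (fun M => fun e => decide (e ∉ M)))) := by
  sorry

open Classical in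
/-- STUB `stub_narrowAlgebraic` (M/L; provable now): the width threshold — PERM/GRANK gates of width
`≤ ⌊m^{1/16}⌋₊` are sandwichable in the worst case (minterms of length `≤ log₂(T!)` resp. `≤ θ ≤ T`,
so `φ ∘ D` is an `ℓ`-DNF over the edges, `ℓ ≤ (r-1)·log₂(T!)`; switch up once, down once; two mass
lemmas). (= `NarrowAlgebraicStatement`.) -/
theorem stub_narrowAlgebraic : ∀ c : ℕ, ∃ r₀ s₀ : ℕ, 2 ≤ r₀ ∧ 2 ≤ s₀ ∧ ∀ r s : ℕ, r₀ ≤ r → s₀ ≤ s →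
    ∀ᶠ m : ℕ in atTop, ∀ φ : GateFn,
      (IsPermGate ⌊(m : ℝ) ^ (1 / 16 : ℝ)⌋₊ φ ∨ IsGRankGate ⌊(m : ℝ) ^ (1 / 16 : ℝ)⌋₊ φ) →
      ∀ (D C : Fin φ.1 → Finset (Finset ((⊤ : SimpleGraph (Fin m)).edgeSet))),
        #(univ.image fun j => (D j, C j)) ≤ m ^ (c + 3) →
        (∀ j, ∀ R ∈ D j, #R ≤ r - 1) → (∀ j, ∀ S ∈ C j, #S ≤ s - 1) →
        (∀ j x, EvalDNF (D j) x → EvalCNF (C j) x) →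
        ∃ dnf cnf : Finset (Finset ((⊤ : SimpleGraph (Fin m)).edgeSet)),
          (∀ R ∈ dnf, #R ≤ r - 1) ∧ (∀ S ∈ cnf, #S ≤ s - 1) ∧
          (∀ x, EvalDNF dnf x → EvalCNF cnf x) ∧
          (#((posGraphs m ⌈(m : ℝ) ^ (1 / 4 : ℝ)⌉₊).filter
              (fun x => φ.2 (fun j => decide (EvalDNF (D j) x)) = true ∧ ¬ EvalDNF dnf x)) : ℝ)
            ≤ (1 / (8 * (m : ℝ) ^ (c + 1))) * #(posGraphs m ⌈(m : ℝ) ^ (1 / 4 : ℝ)⌉₊) ∧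
          (#((((powersetCard (Fintype.card ((⊤ : SimpleGraph (Fin m)).edgeSet) / ⌊(m : ℝ) ^ (1 / 8 : ℝ)⌋₊)
          (univ : Finset ((⊤ : SimpleGraph (Fin m)).edgeSet))).image (fun M => fun e => decide (e ∉ M)))).filter
              (fun x => EvalCNF cnf x ∧ φ.2 (fun j => decide (EvalCNF (C j) x)) = false)) : ℝ)
            ≤ (1 / (8 * (m : ℝ) ^ (c + 1))) *
              #(((powersetCard (Fintype.card ((⊤ : SimpleGraph (Fin m)).edgeSet) / ⌊(m : ℝ) ^ (1 / 8 : ℝ)⌋₊)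
          (univ : Finset ((⊤ : SimpleGraph (Fin m)).edgeSet))).image (fun M => fun e => decide (e ∉ M)))) := by
  sorry

open Classical in
/-- STUB `stub_algebraicReplaceable` (XL; open): PERM/GRANK gates of width in `(⌊m^{1/16}⌋₊, m^c]` are
replaceable, on the referee push-forwards through `≤ m^{c+3}` distinct local child pairs, by a
`{∧₂,∨₂,0,1}`-circuit with `≤ m^a` gates, `a = a(c)`. (= `AlgebraicReplaceableStatement`.) -/
theorem stub_algebraicReplaceable : ∀ c : ℕ, ∃ a : ℕ, ∀ r s : ℕ, 2 ≤ r → 2 ≤ s →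
    ∀ᶠ m : ℕ in atTop, ∀ φ : GateFn, (IsPermGate (m ^ c) φ ∨ IsGRankGate (m ^ c) φ) →
      ¬ (IsPermGate ⌊(m : ℝ) ^ (1 / 16 : ℝ)⌋₊ φ ∨ IsGRankGate ⌊(m : ℝ) ^ (1 / 16 : ℝ)⌋₊ φ) →
      ∀ (D C : Fin φ.1 → Finset (Finset ((⊤ : SimpleGraph (Fin m)).edgeSet))),
        #(univ.image fun j => (D j, C j)) ≤ m ^ (c + 3) →
        (∀ j, ∀ R ∈ D j, #R ≤ r - 1) → (∀ j, ∀ S ∈ C j, #S ≤ s - 1) →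
        (∀ j x, EvalDNF (D j) x → EvalCNF (C j) x) →
        ∃ Ψ : Circuit (Fin φ.1), Ψ.IsOver monotoneBasis01 ∧ Ψ.size ≤ m ^ a ∧
          (#((posGraphs m ⌈(m : ℝ) ^ (1 / 4 : ℝ)⌉₊).filter
              (fun x => φ.2 (fun j => decide (EvalDNF (D j) x)) = true ∧
                Ψ.eval (fun j => decide (EvalDNF (D j) x)) = false)) : ℝ)
            ≤ (1 / (8 * (m : ℝ) ^ (c + 1))) * #(posGraphs m ⌈(m : ℝ) ^ (1 / 4 : ℝ)⌉₊) ∧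
          (#((((powersetCard (Fintype.card ((⊤ : SimpleGraph (Fin m)).edgeSet) / ⌊(m : ℝ) ^ (1 / 8 : ℝ)⌋₊)
          (univ : Finset ((⊤ : SimpleGraph (Fin m)).edgeSet))).image (fun M => fun e => decide (e ∉ M)))).filter
              (fun x => Ψ.eval (fun j => decide (EvalCNF (C j) x)) = true ∧
                φ.2 (fun j => decide (EvalCNF (C j) x)) = false)) : ℝ)
            ≤ (1 / (8 * (m : ℝ) ^ (c + 1))) *
              #(((powersetCard (Fintype.card ((⊤ : SimpleGraph (Fin m)).edgeSet) / ⌊(m : ℝ) ^ (1 / 8 : ℝ)⌋₊)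
          (univ : Finset ((⊤ : SimpleGraph (Fin m)).edgeSet))).image (fun M => fun e => decide (e ∉ M)))) := by
  sorry

open Classical in
/-- STUB `stub_convReplaceable` (XL; open, HARDEST — contains the single-gate case of crux #2
`ConvexGateBlind` on this pair): CONV gates of width `≤ m^c` are replaceable, on the referee
push-forwards through `≤ m^{c+3}` distinct local child pairs, by a `{∧₂,∨₂,0,1}`-circuit with `≤ m^a`
gates, `a = a(c)`. (= `ConvReplaceableStatement`.) -/
theorem stub_convReplaceable : ∀ c : ℕ, ∃ a : ℕ, ∀ r s : ℕ, 2 ≤ r → 2 ≤ s →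
    ∀ᶠ m : ℕ in atTop, ∀ φ : GateFn, IsConvGate (m ^ c) φ →
      ∀ (D C : Fin φ.1 → Finset (Finset ((⊤ : SimpleGraph (Fin m)).edgeSet))),
        #(univ.image fun j => (D j, C j)) ≤ m ^ (c + 3) →
        (∀ j, ∀ R ∈ D j, #R ≤ r - 1) → (∀ j, ∀ S ∈ C j, #S ≤ s - 1) →
        (∀ j x, EvalDNF (D j) x → EvalCNF (C j) x) →
        ∃ Ψ : Circuit (Fin φ.1), Ψ.IsOver monotoneBasis01 ∧ Ψ.size ≤ m ^ a ∧
          (#((posGraphs m ⌈(m : ℝ) ^ (1 / 4 : ℝ)⌉₊).filter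
              (fun x => φ.2 (fun j => decide (EvalDNF (D j) x)) = true ∧
                Ψ.eval (fun j => decide (EvalDNF (D j) x)) = false)) : ℝ)
            ≤ (1 / (8 * (m : ℝ) ^ (c + 1))) * #(posGraphs m ⌈(m : ℝ) ^ (1 / 4 : ℝ)⌉₊) ∧
          (#((((powersetCard (Fintype.card ((⊤ : SimpleGraph (Fin m)).edgeSet) / ⌊(m : ℝ) ^ (1 / 8 : ℝ)⌋₊)
          (univ : Finset ((⊤ : SimpleGraph (Fin m)).edgeSet))).image (fun M => fun e => decide (e ∉ M)))).filter
              (fun x => Ψ.eval (fun j => decide (EvalCNF (C j) x)) = true ∧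
                φ.2 (fun j => decide (EvalCNF (C j) x)) = false)) : ℝ)
            ≤ (1 / (8 * (m : ℝ) ^ (c + 1))) *
              #(((powersetCard (Fintype.card ((⊤ : SimpleGraph (Fin m)).edgeSet) / ⌊(m : ℝ) ^ (1 / 8 : ℝ)⌋₊)
          (univ : Finset ((⊤ : SimpleGraph (Fin m)).edgeSet))).image (fun M => fun e => decide (e ∉ M)))) := by
  sorry

-- The registered stubs ARE the §3 statements (definitional unfolding; this block is the check).
open Classical in
example : EngineStatement ∧ RefereeStatement ∧ InlineStatement ∧ NarrowAlgebraicStatement ∧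
    AlgebraicReplaceableStatement ∧ ConvReplaceableStatement :=
  ⟨stub_engine, stub_referee, stub_inline, stub_narrowAlgebraic, stub_algebraicReplaceable,
    stub_convReplaceable⟩

/-! ## §5 Composition lemmas (proved) -/

section CompositionLemmas

variable {ι : Type} [DecidableEq ι]

/-- Sandwichability is monotone in the error budget. -/
theorem Sandwichable.of_le {r s A : ℕ} {P N : Finset (ι → Bool)} {ε ε' : ℝ} {φ : GateFn}
    (h : Sandwichable r s A P N ε φ) (hle : ε ≤ ε') : Sandwichable r s A P N ε' φ := by
  intro d c hA hd hc hdc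
  obtain ⟨dnf, cnf, h1, h2, h3, h4, h5⟩ := h d c hA hd hc hdc
  exact ⟨dnf, cnf, h1, h2, h3, h4.trans (mul_le_mul_of_nonneg_right hle (Nat.cast_nonneg _)),
    h5.trans (mul_le_mul_of_nonneg_right hle (Nat.cast_nonneg _))⟩

/-- Card of a filter bounded by two filters covering it (instance-agnostic bookkeeping). -/
theorem card_filter_le_add {α : Type} (S : Finset α) (p q₁ q₂ : α → Prop) [DecidablePred p]
    [DecidablePred q₁] [DecidablePred q₂] (h : ∀ x ∈ S, p x → q₁ x ∨ q₂ x) :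
    (#(S.filter p) : ℝ) ≤ #(S.filter q₁) + #(S.filter q₂) := by
  classical
  have : #(S.filter p) ≤ #(S.filter q₁ ∪ S.filter q₂) := by
    refine card_le_card fun x hx => ?_
    rw [mem_filter] at hx
    rw [mem_union, mem_filter, mem_filter]
    rcases h x hx.1 hx.2 with h1 | h1
    · exact Or.inl ⟨hx.1, h1⟩
    · exact Or.inr ⟨hx.1, h1⟩
  exact_mod_cast this.trans (card_union_le _ _)

/-- REPLACEABLE + INLINE-FREE ⇒ SANDWICHABLE (errors add): the line's reduction of a wide gate to its
low-complexity replacement. -/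
theorem sandwichable_of_replaceable {r s A a : ℕ} {P N : Finset (ι → Bool)} {ε ε' : ℝ} {φ : GateFn}
    (hR : Replaceable r s A a P N ε φ) (hI : InlineFree r s a P N ε') :
    Sandwichable r s A P N (ε + ε') φ := by
  classical
  intro d c hA hd hc hdc
  obtain ⟨Ψ, hΨ, hsz, hP, hN⟩ := hR d c hA hd hc hdc
  obtain ⟨dnf, cnf, h1, h2, h3, h4, h5⟩ := hI φ.1 Ψ hΨ hsz d c hd hc hdc
  refine ⟨dnf, cnf, h1, h2, h3, ?_, ?_⟩
  · calc (#(P.filter fun x => φ.2 (dval d x) = true ∧ ¬ EvalDNF dnf x) : ℝ)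
        ≤ #(P.filter fun x => φ.2 (dval d x) = true ∧ Ψ.eval (dval d x) = false) +
            #(P.filter fun x => Ψ.eval (dval d x) = true ∧ ¬ EvalDNF dnf x) := by
          refine card_filter_le_add P _ _ _ fun x _ hx => ?_
          cases hΨx : Ψ.eval (dval d x)
          · exact Or.inl ⟨hx.1, rfl⟩
          · exact Or.inr ⟨rfl, hx.2⟩
      _ ≤ ε * #P + ε' * #P := add_le_add hP h4
      _ = (ε + ε') * #P := by ring
  · calc (#(N.filter fun x => EvalCNF cnf x ∧ φ.2 (cval c x) = false) : ℝ)
        ≤ #(N.filter fun x => Ψ.eval (cval c x) = true ∧ φ.2 (cval c x) = false) +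
            #(N.filter fun x => EvalCNF cnf x ∧ Ψ.eval (cval c x) = false) := by
          refine card_filter_le_add N _ _ _ fun x _ hx => ?_
          cases hΨx : Ψ.eval (cval c x)
          · exact Or.inr ⟨hx.1, rfl⟩
          · exact Or.inl ⟨rfl, hx.2⟩
      _ ≤ ε * #N + ε' * #N := add_le_add hN h5
      _ = (ε + ε') * #N := by ring

end CompositionLemmas

/-! ## §6 The per-`m` core and the composition -/

/-- Positives are accepted by `CLIQUE(m, k)`. -/
theorem cliqueFn_of_mem_posFam {m : ℕ} {x : EV m → Bool} (hx : x ∈ posFam m) :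
    cliqueFn m (kk m) x = true :=
  cliqueFn_of_mem_posGraphs hx

/-- There are positives as soon as `1 ≤ m` (`k ≤ m`). -/
theorem posFam_card_pos {m : ℕ} (hm : 1 ≤ m) : 0 < #(posFam m) := by
  refine Finset.card_pos.2 (posGraphs_nonempty ?_)
  exact ceil_rpow_le (δ := 1 / 4) (by norm_num) hm

/-- There are negatives (always: `t ≤ #E`). -/
theorem negFam_card_pos (m : ℕ) : 0 < #(negFam m) := by
  refine Finset.card_pos.2 (Finset.Nonempty.image ?_ _)
  rw [Finset.powersetCard_nonempty, Finset.card_univ]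
  exact Nat.div_le_self _ _

/-- Size bookkeeping: `#E(K_m) + m^c + 1 ≤ m^{c+3}` for `m ≥ 3`. -/
theorem card_EV_add_le {m : ℕ} (hm : 3 ≤ m) (c : ℕ) :
    Fintype.card (EV m) + m ^ c + 1 ≤ m ^ (c + 3) := by
  have h1 : 1 ≤ m := by omega
  have hE : Fintype.card (EV m) ≤ m ^ (c + 2) := by
    calc Fintype.card (EV m)
        ≤ Fintype.card (Sym2 (Fin m)) := Fintype.card_le_of_injective Subtype.val Subtype.val_injective
      _ ≤ Fintype.card (Fin m × Fin m) :=
          Fintype.card_le_of_surjective (Sym2.mk (α := Fin m)).uncurry Sym2.mk_surjective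
      _ = m ^ 2 := by simp [sq]
      _ ≤ m ^ (c + 2) := Nat.pow_le_pow_right h1 (by omega)
  have hc : m ^ c ≤ m ^ (c + 2) := Nat.pow_le_pow_right h1 (by omega)
  have h2 : 1 ≤ m ^ (c + 2) := Nat.one_le_pow _ _ h1
  calc Fintype.card (EV m) + m ^ c + 1 ≤ 3 * m ^ (c + 2) := by omega
    _ ≤ m * m ^ (c + 2) := Nat.mul_le_mul_right _ hm
    _ = m ^ (c + 3) := by ring

/-- Error bookkeeping: `size · 2ε(m,c) ≤ 1/4` for `size ≤ m^c`, `m ≥ 1`. -/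
theorem size_mul_eps_le {m c sz : ℕ} (hm : 1 ≤ m) (hsz : sz ≤ m ^ c) :
    (sz : ℝ) * (2 * eps m c) ≤ 1 / 4 := by
  have hm' : (1 : ℝ) ≤ m := by exact_mod_cast hm
  have hmpos : (0 : ℝ) < (m : ℝ) ^ c := by positivity
  have hsz' : (sz : ℝ) ≤ (m : ℝ) ^ c := by exact_mod_cast hsz
  have hpow : (m : ℝ) ^ c ≤ (m : ℝ) ^ (c + 1) := by
    rw [pow_succ]
    exact le_mul_of_one_le_right hmpos.le hm'
  have hpos : (0 : ℝ) < 8 * (m : ℝ) ^ (c + 1) := by positivity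
  unfold eps
  rw [show (sz : ℝ) * (2 * (1 / (8 * (m : ℝ) ^ (c + 1)))) = sz / (4 * (m : ℝ) ^ (c + 1)) by
    field_simp; ring]
  rw [div_le_div_iff₀ (by positivity) (by norm_num)]
  nlinarith

/-- THE PER-`m` CORE: if every gate of a monotone basis `B` is sandwichable on the referee pair with error
`2ε(m,c)` and the referee pair is nondegenerate at locality `s`, then no `B`-circuit with `≤ m^c` gates
computes `CLIQUE(m, k(m))` — the engine's two exits are both absurd. -/
theorem core (hE : EngineStatement) {m c r s : ℕ} (hr : 2 ≤ r) (hs : 2 ≤ s) (hm : 3 ≤ m)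
    (href₁ : 4 * #((negFam m).filter fun x => cliqueFn m (kk m) x = true) ≤ #(negFam m))
    (href₂ : ∀ q : Finset (EV m), #q ≤ s →
      4 * #((posFam m).filter fun x => ∃ e ∈ q, x e = true) ≤ #(posFam m))
    {B : Set GateFn} (hBmono : ∀ φ ∈ B, Monotone φ.2)
    (hgates : ∀ φ ∈ B, Sandwichable r s (m ^ (c + 3)) (posFam m) (negFam m) (2 * eps m c) φ)
    (C : Circuit (EV m)) (hC : C.IsOver B) (hsize : C.size ≤ m ^ c) :
    ¬ C.Computes (cliqueFn m (kk m)) := by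
  classical
  intro hcomp
  have h1 : 1 ≤ m := by omega
  have hε : (0 : ℝ) ≤ 2 * eps m c := by unfold eps; positivity
  have hA : Fintype.card (EV m) + C.size + 1 ≤ m ^ (c + 3) :=
    le_trans (by omega) (card_EV_add_le hm c)
  have key := hE (EV m) r s (m ^ (c + 3)) hr hs (posFam m) (negFam m) (2 * eps m c) hε C hA
    (fun g hg => hBmono g.fn (hC g hg)) (fun g hg => hgates g.fn (hC g hg))
    (cliqueFn m (kk m)) hcomp
  have hq : (C.size : ℝ) * (2 * eps m c) ≤ 1 / 4 := size_mul_eps_le h1 hsize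
  have hPpos : (0 : ℝ) < #(posFam m) := by exact_mod_cast posFam_card_pos h1
  have hNpos : (0 : ℝ) < #(negFam m) := by exact_mod_cast negFam_card_pos m
  rcases key with h | ⟨q, hqs, h⟩
  · -- exit 1: almost every negative would contain a `k`-clique
    have hsplit : #((negFam m).filter fun x => cliqueFn m (kk m) x = true) +
        #((negFam m).filter fun x => cliqueFn m (kk m) x = false) = #(negFam m) := by
      have := card_filter_add_card_filter_not
        (s := negFam m) (p := fun x => cliqueFn m (kk m) x = true)
      rw [← this]
      congr 1
      exact congrArg card (filter_congr fun x _ => by simp)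
    have e1 : (#((negFam m).filter fun x => cliqueFn m (kk m) x = true) : ℝ) +
        #((negFam m).filter fun x => cliqueFn m (kk m) x = false) = #(negFam m) := by
      exact_mod_cast hsplit
    have e2 : 4 * (#((negFam m).filter fun x => cliqueFn m (kk m) x = true) : ℝ) ≤ #(negFam m) := by
      exact_mod_cast href₁
    have e3 : (#((negFam m).filter fun x => cliqueFn m (kk m) x = false) : ℝ) ≤ #(negFam m) / 4 := by
      refine h.trans ?_
      have := mul_le_mul_of_nonneg_right hq hNpos.le
      linarith
    linarith
  · -- exit 2: almost every bare clique would meet a fixed set of fewer than `s` edges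
    have hall : ∀ x ∈ posFam m, cliqueFn m (kk m) x = true := fun x hx => cliqueFn_of_mem_posFam hx
    have hsplit : #((posFam m).filter fun x => ∃ e ∈ q, x e = true) +
        #((posFam m).filter fun x => cliqueFn m (kk m) x = true ∧ ∀ e ∈ q, x e = false) =
          #(posFam m) := by
      have := card_filter_add_card_filter_not
        (s := posFam m) (p := fun x => ∃ e ∈ q, x e = true)
      rw [← this]
      congr 1
      refine congrArg card (filter_congr fun x hx => ?_)
      simp only [hall x hx, true_and, not_exists, not_and, Bool.not_eq_true]
    have e1 : (#((posFam m).filter fun x => ∃ e ∈ q, x e = true) : ℝ) +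
        #((posFam m).filter fun x => cliqueFn m (kk m) x = true ∧ ∀ e ∈ q, x e = false) =
          #(posFam m) := by
      exact_mod_cast hsplit
    have e2 : 4 * (#((posFam m).filter fun x => ∃ e ∈ q, x e = true) : ℝ) ≤ #(posFam m) := by
      exact_mod_cast href₂ q (by omega)
    have e3 : (#((posFam m).filter fun x => cliqueFn m (kk m) x = true ∧ ∀ e ∈ q, x e = false) : ℝ)
        ≤ #(posFam m) / 4 := by
      refine h.trans ?_
      have := mul_le_mul_of_nonneg_right hq hPpos.le
      linarith
    linarith

/-- EVERY GATE OF `B_{m^c}` IS SANDWICHABLE, from the four per-class stubs at one `m` (case split of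
`mem_extGate_iff`; `∧₂, ∨₂ ∈ CONV₁ ⊆ CONV_{m^c}`; narrow vs wide PERM/GRANK by the threshold `T(m)`). -/
theorem gates_sandwichable {m c r s a₁ a₂ : ℕ} (hm : 1 ≤ m)
    (hI₁ : InlineFree r s (m ^ a₁) (posFam m) (negFam m) (eps m c))
    (hI₂ : InlineFree r s (m ^ a₂) (posFam m) (negFam m) (eps m c))
    (hN : ∀ φ : GateFn, (IsPermGate (TT m) φ ∨ IsGRankGate (TT m) φ) →
      Sandwichable r s (m ^ (c + 3)) (posFam m) (negFam m) (eps m c) φ)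
    (hAlg : ∀ φ : GateFn, (IsPermGate (m ^ c) φ ∨ IsGRankGate (m ^ c) φ) →
      ¬ (IsPermGate (TT m) φ ∨ IsGRankGate (TT m) φ) →
      Replaceable r s (m ^ (c + 3)) (m ^ a₂) (posFam m) (negFam m) (eps m c) φ)
    (hConv : ∀ φ : GateFn, IsConvGate (m ^ c) φ →
      Replaceable r s (m ^ (c + 3)) (m ^ a₁) (posFam m) (negFam m) (eps m c) φ)
    (φ : GateFn) (hφ : φ ∈ extGate (m ^ c)) :
    Sandwichable r s (m ^ (c + 3)) (posFam m) (negFam m) (2 * eps m c) φ := by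
  have h1c : 1 ≤ m ^ c := Nat.one_le_pow _ _ hm
  have hε0 : 0 ≤ eps m c := by unfold eps; positivity
  have htwo : eps m c + eps m c = 2 * eps m c := by ring
  have conv_case : IsConvGate (m ^ c) φ →
      Sandwichable r s (m ^ (c + 3)) (posFam m) (negFam m) (2 * eps m c) φ := fun h =>
    htwo ▸ sandwichable_of_replaceable (hConv φ h) hI₁
  have alg_case : (IsPermGate (m ^ c) φ ∨ IsGRankGate (m ^ c) φ) →
      Sandwichable r s (m ^ (c + 3)) (posFam m) (negFam m) (2 * eps m c) φ := fun h => by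
    by_cases hn : IsPermGate (TT m) φ ∨ IsGRankGate (TT m) φ
    · exact (hN φ hn).of_le (by linarith)
    · exact htwo ▸ sandwichable_of_replaceable (hAlg φ h hn) hI₂
  rw [mem_extGate_iff] at hφ
  rcases hφ with rfl | rfl | h | h | h
  · exact conv_case ((and_isConvGate 2).mono h1c)
  · exact conv_case ((or_isConvGate 2).mono h1c)
  · exact conv_case h
  · exact alg_case (Or.inl h)
  · exact alg_case (Or.inr h)

/-- THE LOWER BOUND AT `k(m) = ⌈m^{1/4}⌉₊` from the six stub statements: pick `r, s` as maxima of the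
thresholds, intersect the eventualities, and run `core`. -/
theorem lowerBoundAt_of (hE : EngineStatement) (hRef : RefereeStatement) (hI : InlineStatement)
    (hN : NarrowAlgebraicStatement) (hAlg : AlgebraicReplaceableStatement)
    (hConv : ConvReplaceableStatement) : LowerBoundAt kk := by
  intro c
  obtain ⟨a₁, hConv⟩ := hConv c
  obtain ⟨a₂, hAlg⟩ := hAlg c
  obtain ⟨r₁, s₁, hr₁, hs₁, hI₁⟩ := hI a₁ c
  obtain ⟨r₂, s₂, hr₂, hs₂, hI₂⟩ := hI a₂ c
  obtain ⟨r₃, s₃, hr₃, hs₃, hN⟩ := hN c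
  set r := max r₁ (max r₂ r₃) with hr
  set s := max s₁ (max s₂ s₃) with hs
  have hr2 : 2 ≤ r := le_trans hr₁ (le_max_left _ _)
  have hs2 : 2 ≤ s := le_trans hs₁ (le_max_left _ _)
  have E₁ := hI₁ r s (le_max_left _ _) (le_max_left _ _)
  have E₂ := hI₂ r s ((le_max_left _ _).trans (le_max_right _ _))
    ((le_max_left _ _).trans (le_max_right _ _))
  have E₃ := hN r s ((le_max_right _ _).trans (le_max_right _ _))
    ((le_max_right _ _).trans (le_max_right _ _))
  have E₄ := hAlg r s hr2 hs2
  have E₅ := hConv r s hr2 hs2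
  have E₆ := hRef s
  filter_upwards [E₁, E₂, E₃, E₄, E₅, E₆, eventually_ge_atTop 3] with m h₁ h₂ h₃ h₄ h₅ h₆ hm C hC hsize
  exact core hE hr2 hs2 hm h₆.1 h₆.2 (fun φ hφ => extGate_monotone hφ)
    (gates_sandwichable (by omega) h₁ h₂ h₃ h₄ h₅) C hC hsize


/-! ## §7 The width threshold as a tightness lemma (for the disprover): the NARROW lower bound from the
four provable-now stubs only -/

/-- `∧₂` and `∨₂` are replaceable by themselves (monotone complexity `1`, no error). -/
theorem replaceable_of_mem_monotoneBasis {ι : Type} [DecidableEq ι] {r s A a : ℕ} (ha : 1 ≤ a)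
    {P N : Finset (ι → Bool)} {ε : ℝ} (hε : 0 ≤ ε) {φ : GateFn} (hφ : φ ∈ monotoneBasis) :
    Replaceable r s A a P N ε φ := by
  classical
  intro d c _ _ _ _
  obtain ⟨Ψ, hΨ, hsz, he⟩ :=
    (CktSize.gate (B := monotoneBasis01) φ (monotoneBasis_subset_monotoneBasis01 hφ) id).toCircuit
  refine ⟨Ψ, hΨ, hsz.trans ha, ?_, ?_⟩
  · have h0 : P.filter (fun x => φ.2 (dval d x) = true ∧ Ψ.eval (dval d x) = false) = ∅ := by
      refine Finset.filter_eq_empty_iff.2 fun x _ h => ?_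
      rw [he] at h
      exact Bool.false_ne_true (h.2.symm.trans h.1)
    rw [h0, card_empty, Nat.cast_zero]
    positivity
  · have h0 : N.filter (fun x => Ψ.eval (cval c x) = true ∧ φ.2 (cval c x) = false) = ∅ := by
      refine Finset.filter_eq_empty_iff.2 fun x _ h => ?_
      rw [he] at h
      exact Bool.false_ne_true (h.2.symm.trans h.1)
    rw [h0, card_empty, Nat.cast_zero]
    positivity

/-- THE NARROW LOWER BOUND (the card's `NarrowExtLowerBound`, in this line's currency): eventually in
`m`, no circuit with `≤ m^c` gates over `{∧₂, ∨₂} ∪ PERM_{T(m)} ∪ GRANK_{T(m)}`, `T(m) = ⌊m^{1/16}⌋₊`,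
computes `CLIQUE(m, ⌈m^{1/4}⌉₊)`. Any counterexample to the crux at `δ = 1/4` must therefore use a CONV
gate or an algebraic gate wider than `⌊m^{1/16}⌋₊` (cf. Disproof: every one-gate kill on record has
width `≥ C(m,k)`). -/
def NarrowLowerBound : Prop :=
  ∀ c : ℕ, ∀ᶠ m : ℕ in atTop, ∀ C : Circuit (EV m),
    C.IsOver (monotoneBasis ∪ {g | IsPermGate (TT m) g ∨ IsGRankGate (TT m) g}) →
      C.size ≤ m ^ c → ¬ C.Computes (cliqueFn m (kk m))

/-- `NarrowLowerBound` from the ENGINE, REFEREE, INLINE and NARROW-ALGEBRAIC stubs alone (all four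
provable now from `MonotoneSwitching.lean`; no distributional input). -/
theorem narrowLowerBound_of (hE : EngineStatement) (hRef : RefereeStatement) (hI : InlineStatement)
    (hN : NarrowAlgebraicStatement) : NarrowLowerBound := by
  intro c
  obtain ⟨r₁, s₁, hr₁, hs₁, hI₁⟩ := hI 0 c
  obtain ⟨r₃, s₃, hr₃, hs₃, hN⟩ := hN c
  set r := max r₁ r₃ with hr
  set s := max s₁ s₃ with hs
  have hr2 : 2 ≤ r := le_trans hr₁ (le_max_left _ _)
  have hs2 : 2 ≤ s := le_trans hs₁ (le_max_left _ _)
  have E₁ := hI₁ r s (le_max_left _ _) (le_max_left _ _)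
  have E₃ := hN r s (le_max_right _ _) (le_max_right _ _)
  have E₆ := hRef s
  filter_upwards [E₁, E₃, E₆, eventually_ge_atTop 3] with m h₁ h₃ h₆ hm C hC hsize
  have hε0 : 0 ≤ eps m c := by unfold eps; positivity
  have htwo : eps m c + eps m c = 2 * eps m c := by ring
  refine core hE hr2 hs2 hm h₆.1 h₆.2 (B := monotoneBasis ∪ {g | IsPermGate (TT m) g ∨ IsGRankGate (TT m) g})
    ?_ ?_ C hC hsize
  · rintro φ (hφ | hφ)
    · rcases hφ with rfl | rfl
      · exact GateFn.and_monotone 2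
      · exact GateFn.or_monotone 2
    · rcases hφ with hφ | hφ
      · exact hφ.monotone
      · exact hφ.monotone
  · rintro φ (hφ | hφ)
    · rw [pow_zero] at h₁
      exact htwo ▸ sandwichable_of_replaceable (replaceable_of_mem_monotoneBasis le_rfl hε0 hφ) h₁
    · exact (h₃ φ hφ).of_le (by linarith)

/-- **THE SKELETON: the six registered stubs prove the crux BY NAME** (real proof; the only `sorry`s are
inside `stub_engine`, `stub_referee`, `stub_inline`, `stub_narrowAlgebraic`, `stub_algebraicReplaceable`,
`stub_convReplaceable`): the lower bound at `⌈m^{1/4}⌉₊` (`lowerBoundAt_of`, fed with the stubs, which are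
definitionally the §3 statements) is the crux at `δ = 1/4 ∈ (0, 1/2)` through the landed bridge
`Negative.cliqueExtLowerBound_iff`. -/
theorem CliqueExtLowerBound_of : Summit.PneNP.PneNP.Theses.ConvexRankGates.CliqueExtLowerBound := by
  rw [cliqueExtLowerBound_iff]
  exact ⟨1 / 4, by norm_num, by norm_num, lowerBoundAt_of stub_engine stub_referee stub_inline
    stub_narrowAlgebraic stub_algebraicReplaceable stub_convReplaceable⟩

/-- The NARROW lower bound from the four provable-now stubs alone (same composition, for the record). -/
theorem narrowLowerBound_of_stubs : NarrowLowerBound :=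
  narrowLowerBound_of stub_engine stub_referee stub_inline stub_narrowAlgebraic

end Summit.PneNP.PneNP.Cruxes.CliqueExtLowerBound.WidthThresholdCertificateSparsity

end
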